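import Literature.NumberTheory.IwasawaTheory.ClassicalMuVanishesCyclicAscentOdd
import Literature.NumberTheory.IwasawaTheory.ClassicalMuVanishesReflectionDescent
import Literature.NumberTheory.NumberFields.CyclotomicPrimePowerPrimesOverBound
import Literature.NumberTheory.NumberFields.SplitPrimesBaseChange
import Literature.NumberTheory.EllipticCurves.CyclotomicZpExtensionLayerProofs
import Mathlib.RingTheory.RootsOfUnity.AlgebraicallyClosed
import Mathlib.NumberTheory.NumberField.Discriminant.Different
import HarnessLib

/-!
# `μ_p = 0` for the cyclotomic `ℤ_p`-extension of every GALOIS NUMBER FIELD OF ODD PRIME DEGREE `p` — unconditionally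
# (Iwasawa 1973 Thm. 2 at odd `ℓ` over the base `ℚ`; proved, no definition, no named fact, no Ferrero–Washington)

`Proofs`-style file (theorems only) in topic `NumberTheory/IwasawaTheory` (namespace `Literature.NumberTheory.IwasawaTheory`), written
by the prover seat `bsd-potss-rkm` g42 (cell `bsd-potss`; library pass next to `ClassicalMuVanishesCyclicAscentOdd.lean`).

For an odd prime `p`, a cyclotomic `ℤ_p`-extension `κ` of `ℚ` (layers `ℚ_n = κ.layer n ⊆ ℚ̄`, `ℚ_n ⊆ ℚ(ζ_{p^{n+1}})`) and a number
field `K'` GALOIS over `ℚ` of degree `p` (a cyclic field of degree `p`) with `κ ∘ res_{K'/ℚ}` onto (i.e. `K' ≠ ℚ_1`; needed to form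
the restricted tower `K'·ℚ_∞/K'` in the tree's currency), **`ClassicalMuVanishes (κ|_{K'})`** — Iwasawa's `μ = 0` in growth form — with
NO appeal to the Ferrero–Washington theorem: the base has `μ = 0` by Iwasawa 1956 (tree `classicalMuVanishes_rat`: `h(ℚ) = 1`, one
prime above `p`, totally ramified), and `μ = 0` ascends the cyclic degree-`p` step by `classicalMuVanishes_restrict_of_isGalois_of_finrank_eq_of_odd`,
whose hypothesis «at most `T` primes of `ℚ_n` ramify in `K'ℚ_n`» is discharged here: a prime of `ℚ_n` ramified in `j'(K')·ℚ_n` lies over a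
rational prime dividing `disc K'` (base change of unramifiedness, tree `isUnramifiedIn_of_isUnramifiedIn_span`), and `ℚ_n ⊆ ℚ(ζ_{p^{n+1}})`
has at most `(ℓ^{p−1} − 1)(p − 1)` primes above `ℓ` uniformly in `n` (tree `CyclotomicPrimePowerPrimesOverBound`), so
`T(K') = ∑_{ℓ ∣ disc K'} (ℓ^{p−1} − 1)(p − 1)` works.

* §1 `layer_le_adjoin_of_isPrimitiveRoot_odd` — `ℚ_n ⊆ ℚ(ζ_{p^{n+1}})` inside `ℚ̄` (odd `p`; tree `rootsOfUnityFixer_le_layerSubgroup`);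
  `ncard_primesOver_layer_le_odd` — `ℚ_n` has at most `(ℓ^{p−1} − 1)(p − 1)` primes above `ℓ`, for every `n`.
* §2 `ncard_ramified_layer_fieldRange_sup_layer_le` — the per-layer ramification bound `T(K')`.
* §3 **`classicalMuVanishes_restrict_rat_of_isGalois_of_finrank_eq_odd`** — the theorem; rank form
  `classGroupPRank_restrict_rat_le_of_isGalois_of_finrank_eq_odd`: `rank_p Cl((K'ℚ_∞)_n) ≤ p · (2 · rank_p Cl(ℚ_n) + T(K'))` for every `n`
  (the general ascent bound, base term kept).
* §4 (appended) `classNumberPExp_rat_eq_zero` / `not_dvd_classNumber_layer_rat` / `classGroupPRank_rat_eq_zero` — `e_n = 0`,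
  `p ∤ h(ℚ_n)`, `rank_p Cl(ℚ_n) = 0` for every `ℤ_p`-extension of `ℚ` (Iwasawa 1956, tree theorem); hence the SHARP rank form
  **`classGroupPRank_restrict_rat_le_mul_ramificationBound_odd`**: `rank_p Cl((K'ℚ_∞)_n) ≤ p · T(K')` for every `n`.

HONEST SCOPE.  Cyclic fields of degree `p` are abelian, so `μ_p = 0` for them is ALSO an instance of Ferrero–Washington; the point of
this file is that the tree proves it with no `L`-function input (Iwasawa 1956 + 1973), exactly as it proves `μ₂ = 0` for imaginary
quadratic fields (`ClassicalMuVanishesImaginaryQuadraticTwoProofs`).  The genuinely non-abelian reach of the ascent (towers of cyclic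
`p`-steps, e.g. `ℚ(E[p]) ⊇ ℚ(ζ_p)` for a curve with a rational `p`-torsion point) uses the same two files with other bases.  Nothing about
elliptic curves or BSD is asserted; no K9/KT row of cell `bsd-potss` consumes this file (library pass).

References: [Iwasawa1973MuInvariants] Thm. 2 (ℓ odd); [Iwasawa1956] (one ramified prime); [Washington1997] Thm. 2.13, §13.1, §13.3
Prop. 13.23; [NeukirchANT1999] Ch. I §8–§9, Ch. III §2 (ramified primes divide the discriminant); [Marcus2018] Ch. 4 Thm. 31 (base change
of unramifiedness).
-/

set_option autoImplicit false

noncomputable section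

open scoped NumberField Classical
open NumberField Field IntermediateField IsDedekindDomain Module

namespace Literature.NumberTheory.IwasawaTheory

open Literature.NumberTheory.EllipticCurves Literature.NumberTheory.EllipticCurves.ZpExtension
  Literature.NumberTheory.GaloisRepresentations Literature.NumberTheory.NumberFields

variable {p : ℕ} [hp : Fact p.Prime]

/-! ## §1 `ℚ_n ⊆ ℚ(ζ_{p^{n+1}})` and the uniform bound on primes of `ℚ_n` above `ℓ` -/

/-- Membership in a layer: `x ∈ K_n ↔ τ • x = x` for all `τ ∈ κ⁻¹(pⁿℤ_p)`. [cite: Washington1997, §13.1] -/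
private theorem mem_layer_iff_smul'' {K : Type} [Field K] (κ : ZpExtension K p) (n : ℕ) (x : AlgebraicClosure K) :
    x ∈ κ.layer n ↔ ∀ τ ∈ κ.layerSubgroup n, τ • x = x := by
  rw [ZpExtension.layer, IntermediateField.mem_fixedField_iff]
  constructor
  · intro h τ hτ
    exact h _ ⟨τ, hτ, rfl⟩
  · rintro h f ⟨τ, hτ, rfl⟩
    exact h τ hτ

/-- **`ℚ_n ⊆ ℚ(ζ_{p^{n+1}})`** inside `ℚ̄` for odd `p` (`κ` cyclotomic, `ζ` a primitive `p^{n+1}`-th root of unity): an automorphism fixing `ζ`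
fixes `μ_{p^{n+1}}`, so lies in `κ⁻¹(pⁿℤ_p) = Gal(ℚ̄/ℚ_n)` (tree `IsCyclotomic.rootsOfUnityFixer_le_layerSubgroup`); Krull.  The odd twin of
`layer_le_adjoin_of_isPrimitiveRoot` (`p = 2`, `ζ_{2^{n+2}}`). [cite: Washington1997, §13.1] -/
theorem layer_le_adjoin_of_isPrimitiveRoot_odd (hodd : p ≠ 2) {κ : ZpExtension ℚ p} (hκ : κ.IsCyclotomic) (n : ℕ)
    {ζ : AlgebraicClosure ℚ} (hζ : IsPrimitiveRoot ζ (p ^ (n + 1))) :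
    κ.layer n ≤ ℚ⟮ζ⟯ := by
  -- the two `ℚ`-algebra structures on `ℚ̄` agree, but not reducibly
  have hq : (DivisionRing.toRatAlgebra : Algebra ℚ (AlgebraicClosure ℚ)) = AlgebraicClosure.instAlgebra ℚ :=
    Subsingleton.elim _ _
  haveI : @Normal ℚ (AlgebraicClosure ℚ) _ _ DivisionRing.toRatAlgebra := by rw [hq]; infer_instance
  haveI : @Algebra.IsSeparable ℚ (AlgebraicClosure ℚ) _ _ DivisionRing.toRatAlgebra := by rw [hq]; infer_instance
  haveI : @IsGalois ℚ _ (AlgebraicClosure ℚ) _ DivisionRing.toRatAlgebra := ⟨⟩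
  haveI : NeZero (p ^ (n + 1)) := ⟨pow_ne_zero _ hp.out.ne_zero⟩
  intro x hx
  have key : x ∈ IntermediateField.fixedField (IntermediateField.fixingSubgroup ℚ⟮ζ⟯) := by
    rw [IntermediateField.mem_fixedField_iff]
    rintro σ hσ
    have hσζ : σ ζ = ζ := (IntermediateField.mem_fixingSubgroup_iff _ σ).mp hσ ζ (mem_adjoin_simple_self ℚ ζ)
    have hmem : σ ∈ rootsOfUnityFixer ℚ (p ^ (n + 1)) := by
      refine (mem_rootsOfUnityFixer_iff).mpr fun t ht => ?_
      obtain ⟨i, -, rfl⟩ := hζ.eq_pow_of_pow_eq_one ht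
      show σ (ζ ^ i) = ζ ^ i
      rw [map_pow, hσζ]
    exact (mem_layer_iff_smul'' κ n x).mp hx σ (hκ.rootsOfUnityFixer_le_layerSubgroup hodd n hmem)
  exact (InfiniteGalois.fixedField_fixingSubgroup ℚ⟮ζ⟯).le key

/-- **At most `(ℓ^{p−1} − 1)(p − 1)` primes of `ℚ_n` above each rational prime `ℓ`, uniformly in `n`** (`p` odd; `ℚ_n ⊆ ℚ(ζ_{p^{n+1}})`,
tree `ncard_primesOver_le_of_algebra_isCyclotomicExtension_prime_pow_odd`). [cite: Washington1997, Thm. 2.13 and §13.1] -/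
theorem ncard_primesOver_layer_le_odd (hodd : p ≠ 2) {κ : ZpExtension ℚ p} (hκ : κ.IsCyclotomic) (n : ℕ) {ℓ : ℕ} (hℓ : ℓ.Prime) :
    (haveI : FiniteDimensional ℚ ↥(κ.layer n) := κ.finiteDimensional_layer_holds n
     haveI : NumberField ↥(κ.layer n) := NumberField.of_module_finite ℚ _
     ((Ideal.span {(ℓ : ℤ)}).primesOver (𝓞 ↥(κ.layer n))).ncard) ≤ (ℓ ^ (p - 1) - 1) * (p - 1) := by
  haveI : FiniteDimensional ℚ ↥(κ.layer n) := κ.finiteDimensional_layer_holds n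
  haveI : NumberField ↥(κ.layer n) := NumberField.of_module_finite ℚ _
  haveI : NeZero (((p ^ (n + 1) : ℕ) : ℚ)) := ⟨by have := hp.out.pos; positivity⟩
  obtain ⟨ζ, hζ⟩ := HasEnoughRootsOfUnity.exists_primitiveRoot (AlgebraicClosure ℚ) (p ^ (n + 1))
  haveI : Algebra.IsAlgebraic ℚ (AlgebraicClosure ℚ) := AlgebraicClosure.isAlgebraic ℚ
  haveI hC : IsCyclotomicExtension {p ^ (n + 1)} ℚ ↥ℚ⟮ζ⟯ := hζ.intermediateField_adjoin_isCyclotomicExtension ℚ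
  haveI : FiniteDimensional ℚ ↥ℚ⟮ζ⟯ := IsCyclotomicExtension.finite {p ^ (n + 1)} ℚ ↥ℚ⟮ζ⟯
  haveI : NumberField ↥ℚ⟮ζ⟯ := NumberField.of_module_finite ℚ _
  have hle : κ.layer n ≤ ℚ⟮ζ⟯ := layer_le_adjoin_of_isPrimitiveRoot_odd hodd hκ n hζ
  letI : Algebra ↥(κ.layer n) ↥ℚ⟮ζ⟯ := (IntermediateField.inclusion hle).toRingHom.toAlgebra
  exact ncard_primesOver_le_of_algebra_isCyclotomicExtension_prime_pow_odd ↥ℚ⟮ζ⟯ p n hodd ↥(κ.layer n) hℓ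

/-! ## §2 The per-layer ramification bound -/

/-- The rational prime under a maximal ideal of a ring of integers. [folklore] -/
private theorem exists_prime_liesOver'' {L : Type*} [Field L] [NumberField L] (P : Ideal (𝓞 L)) [P.IsMaximal] :
    ∃ q : ℕ, q.Prime ∧ P.LiesOver (Ideal.span {(q : ℤ)}) := by
  have hP0 : P ≠ ⊥ := Ring.ne_bot_of_isMaximal_of_not_isField ‹_› (RingOfIntegers.not_isField L)
  haveI : (P.under ℤ).IsPrime := Ideal.IsPrime.under ℤ P
  have hPZ0 : P.under ℤ ≠ ⊥ := mt Ideal.eq_bot_of_comap_eq_bot hP0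
  set g := Submodule.IsPrincipal.generator (P.under ℤ) with hgdef
  have hg : Ideal.span {g} = P.under ℤ := Ideal.span_singleton_generator (P.under ℤ)
  have hg0 : g ≠ 0 := fun h => hPZ0 (by rw [← hg, h, Ideal.span_singleton_eq_bot])
  have hgprime : Prime g := (Ideal.span_singleton_prime hg0).mp (hg.symm ▸ inferInstance)
  refine ⟨g.natAbs, Int.prime_iff_natAbs_prime.mp hgprime, ⟨?_⟩⟩
  rw [Int.span_natAbs, hg]

/-- **At most `T(K') = ∑_{ℓ ∣ disc K'} (ℓ^{p−1} − 1)(p − 1)` primes of `ℚ_n` ramify in `j'(K')·ℚ_n`, for every `n`** (`K'/ℚ` Galois of odd prime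
degree `p`, `κ ∘ res` onto, `κ` cyclotomic): `j'(K')·ℚ_n` is Galois over `ℚ_n` of prime degree `p`, hence generated by the image of `K'`; a
prime `v` of `ℚ_n` ramified in it lies over a rational prime `q` ramified in `K'` (base change, tree `isUnramifiedIn_of_isUnramifiedIn_span`),
i.e. `q ∣ disc K'` (Mathlib), and `ℚ_n` has at most `(q^{p−1}−1)(p−1)` primes above `q` (§1).
[cite: NeukirchANT1999, Ch. III §2 Thm. (2.6) and Cor. (2.12) (ramified primes divide the discriminant)] [cite: Marcus2018, Ch. 4 Thm. 31]
[cite: Washington1997, §13.1] -/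
theorem ncard_ramified_layer_fieldRange_sup_layer_le (hodd : p ≠ 2) {κ : ZpExtension ℚ p} (hκ : κ.IsCyclotomic)
    (K' : Type) [Field K'] [NumberField K'] [IsGalois ℚ K'] (hdeg : Module.finrank ℚ K' = p)
    (hK' : Function.Surjective (κ.toContinuousMonoidHom.comp (absGaloisRestrict ℚ K')))
    (j' : K' →ₐ[ℚ] AlgebraicClosure ℚ) (n : ℕ) :
    letI : Algebra ↥(κ.layer n) ↥(j'.fieldRange ⊔ κ.layer n) :=
      (IntermediateField.inclusion (le_sup_right : κ.layer n ≤ j'.fieldRange ⊔ κ.layer n)).toRingHom.toAlgebra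
    {v : HeightOneSpectrum (𝓞 ↥(κ.layer n)) |
        v.asIdeal.ramificationIdxIn (𝓞 ↥(j'.fieldRange ⊔ κ.layer n)) ≠ 1}.ncard ≤
      ∑ ℓ ∈ (NumberField.discr K').natAbs.primeFactors, (ℓ ^ (p - 1) - 1) * (p - 1) := by
  classical
  have hpp : p.Prime := hp.out
  haveI : FiniteDimensional ℚ ↥(κ.layer n) := κ.finiteDimensional_layer_holds n
  haveI : NumberField ↥(κ.layer n) := NumberField.of_module_finite ℚ _
  haveI : NumberField ↥(j'.fieldRange ⊔ κ.layer n) := numberField_fieldRange_sup_layer κ K' j' n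
  have hle : κ.layer n ≤ j'.fieldRange ⊔ κ.layer n := le_sup_right
  letI algL : Algebra ↥(κ.layer n) ↥(j'.fieldRange ⊔ κ.layer n) := (IntermediateField.inclusion hle).toRingHom.toAlgebra
  haveI : IsScalarTower ℚ ↥(κ.layer n) ↥(j'.fieldRange ⊔ κ.layer n) := IsScalarTower.of_algebraMap_eq fun _ => rfl
  let eK : K' →+* ↥(j'.fieldRange ⊔ κ.layer n) :=
    (j' : K' →+* AlgebraicClosure ℚ).codRestrict (j'.fieldRange ⊔ κ.layer n) fun x =>
      (le_sup_left : j'.fieldRange ≤ j'.fieldRange ⊔ κ.layer n) (j'.mem_fieldRange.mpr ⟨x, rfl⟩)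
  letI algK : Algebra K' ↥(j'.fieldRange ⊔ κ.layer n) := eK.toAlgebra
  haveI : Module.Free ↥(κ.layer n) ↥(j'.fieldRange ⊔ κ.layer n) := Module.Free.of_divisionRing _ _
  haveI : FiniteDimensional ↥(κ.layer n) ↥(j'.fieldRange ⊔ κ.layer n) :=
    Module.Finite.of_restrictScalars_finite ℚ ↥(κ.layer n) ↥(j'.fieldRange ⊔ κ.layer n)
  -- `[L : ℚ_n] = p`, `L/ℚ_n` Galois
  have hdegL : Module.finrank ↥(κ.layer n) ↥(j'.fieldRange ⊔ κ.layer n) = p :=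
    (finrank_layer_fieldRange_sup_layer κ K' hK' j' n).trans hdeg
  haveI : IsGalois ↥(κ.layer n) ↥(j'.fieldRange ⊔ κ.layer n) := isGalois_layer_fieldRange_sup_layer κ K' j' n
  haveI : IsGaloisGroup (↥(j'.fieldRange ⊔ κ.layer n) ≃ₐ[↥(κ.layer n)] ↥(j'.fieldRange ⊔ κ.layer n)) (𝓞 ↥(κ.layer n))
      (𝓞 ↥(j'.fieldRange ⊔ κ.layer n)) :=
    IsGaloisGroup.of_isFractionRing _ _ _ (↥(κ.layer n)) ↥(j'.fieldRange ⊔ κ.layer n)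
  -- `L` is generated over `ℚ_n` by the image of `K'` (prime degree; `K' ⊄ ℚ_n` by the degree count)
  have hgen : IntermediateField.adjoin (↥(κ.layer n)) (Set.range (algebraMap K' ↥(j'.fieldRange ⊔ κ.layer n))) = ⊤ := by
    set E := IntermediateField.adjoin (↥(κ.layer n)) (Set.range (algebraMap K' ↥(j'.fieldRange ⊔ κ.layer n))) with hE
    have h2 : (Module.finrank (↥(κ.layer n)) ↥(j'.fieldRange ⊔ κ.layer n)).Prime := by rw [hdegL]; exact hpp
    haveI := IntermediateField.isSimpleOrder_of_finrank_prime (↥(κ.layer n)) ↥(j'.fieldRange ⊔ κ.layer n) h2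
    rcases eq_bot_or_eq_top E with h | h
    · exfalso
      -- `j'(K') ⊆ ℚ_n` would give `[j'(K')·ℚ_n : ℚ] = pⁿ`, not `p·pⁿ`
      have hsub : j'.fieldRange ≤ κ.layer n := by
        rintro _ ⟨x, rfl⟩
        have hx : algebraMap K' ↥(j'.fieldRange ⊔ κ.layer n) x ∈
            (⊥ : IntermediateField ↥(κ.layer n) ↥(j'.fieldRange ⊔ κ.layer n)) :=
          h ▸ IntermediateField.subset_adjoin _ _ ⟨x, rfl⟩
        obtain ⟨y, hy⟩ := IntermediateField.mem_bot.mp hx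
        have hy' : ((y : ↥(κ.layer n)) : AlgebraicClosure ℚ) = j' x := by
          have := congrArg (fun z : ↥(j'.fieldRange ⊔ κ.layer n) => (z : AlgebraicClosure ℚ)) hy
          exact this
        exact hy' ▸ y.2
      have heq : j'.fieldRange ⊔ κ.layer n = κ.layer n := sup_eq_right.mpr hsub
      have h1 : Module.finrank ℚ ↥(j'.fieldRange ⊔ κ.layer n) = Module.finrank ℚ K' * p ^ n :=
        finrank_fieldRange_sup_layer κ K' hK' j' n
      have h2' : Module.finrank ℚ ↥(j'.fieldRange ⊔ κ.layer n) = p ^ n := by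
        rw [(IntermediateField.equivOfEq heq).toLinearEquiv.finrank_eq]; exact κ.finrank_layer_holds n
      rw [h2', hdeg] at h1
      have : p ^ n * 1 = p ^ n * p := by rw [mul_one, mul_comm]; exact h1
      exact hpp.one_lt.ne (Nat.eq_of_mul_eq_mul_left (pow_pos hpp.pos n) this)
    · exact h
  -- every ramified prime of `ℚ_n` lies over a prime factor of `disc K'`
  set P := (NumberField.discr K').natAbs.primeFactors with hP
  have hdisc : NumberField.discr K' ≠ 0 := NumberField.discr_ne_zero K'
  have hcover : {v : HeightOneSpectrum (𝓞 ↥(κ.layer n)) |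
      v.asIdeal.ramificationIdxIn (𝓞 ↥(j'.fieldRange ⊔ κ.layer n)) ≠ 1} ⊆
      ⋃ ℓ ∈ P, {v : HeightOneSpectrum (𝓞 ↥(κ.layer n)) | v.asIdeal ∈ (Ideal.span {(ℓ : ℤ)}).primesOver (𝓞 ↥(κ.layer n))} := by
    intro v hv
    haveI := v.isPrime
    obtain ⟨⟨Q, hQ, hQv⟩⟩ := v.asIdeal.nonempty_primesOver (S := 𝓞 ↥(j'.fieldRange ⊔ κ.layer n))
    haveI := hQ; haveI := hQv
    haveI : Q.IsMaximal := hQ.isMaximal (Ideal.ne_bot_of_liesOver_of_ne_bot v.ne_bot Q)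
    obtain ⟨q, hq, hQq⟩ := exists_prime_liesOver'' Q
    haveI := hQq; haveI : Fact q.Prime := ⟨hq⟩
    have hvq : v.asIdeal.LiesOver (Ideal.span {(q : ℤ)}) := Ideal.LiesOver.tower_bot Q v.asIdeal (Ideal.span {(q : ℤ)})
    have hvq' : ((q : ℕ) : 𝓞 ↥(κ.layer n)) ∈ v.asIdeal := by
      have : ((q : ℤ) : ℤ) ∈ Ideal.span {(q : ℤ)} := Ideal.mem_span_singleton_self _
      rw [hvq.over, Ideal.under_def, Ideal.mem_comap] at this
      simpa using this
    have hnot : ¬ Algebra.IsUnramifiedIn (𝓞 ↥(j'.fieldRange ⊔ κ.layer n)) v.asIdeal := fun hunr =>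
      hv ((Ideal.ramificationIdxIn_eq_ramificationIdx v.asIdeal Q
        (↥(j'.fieldRange ⊔ κ.layer n) ≃ₐ[↥(κ.layer n)] ↥(j'.fieldRange ⊔ κ.layer n))).trans
          (hunr.ramificationIdx_eq_one hQv))
    have hqK : ¬ Algebra.IsUnramifiedIn (𝓞 K') (Ideal.span {(q : ℤ)}) := fun hK'' =>
      hnot (isUnramifiedIn_of_isUnramifiedIn_span hgen hq hK'' v hvq')
    have hqd : (q : ℤ) ∣ NumberField.discr K' := by
      by_contra hnd
      exact hqK ((NumberField.not_dvd_discr_iff_isUnramifiedIn K' (𝓞 K') (Nat.prime_iff_prime_int.mp hq)).mp hnd)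
    refine Set.mem_biUnion (x := q) ?_ ?_
    · exact Nat.mem_primeFactors.mpr ⟨hq, Int.natAbs_dvd_natAbs.mpr hqd |>.trans (by simp), Int.natAbs_ne_zero.mpr hdisc⟩
    · exact ⟨v.isPrime, hvq⟩
  have hfin : ∀ ℓ ∈ P,
      ({v : HeightOneSpectrum (𝓞 ↥(κ.layer n)) | v.asIdeal ∈ (Ideal.span {(ℓ : ℤ)}).primesOver (𝓞 ↥(κ.layer n))}).Finite ∧
      ({v : HeightOneSpectrum (𝓞 ↥(κ.layer n)) | v.asIdeal ∈ (Ideal.span {(ℓ : ℤ)}).primesOver (𝓞 ↥(κ.layer n))}).ncard ≤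
        (ℓ ^ (p - 1) - 1) * (p - 1) := by
    intro ℓ hℓ
    have hℓp : ℓ.Prime := Nat.prime_of_mem_primeFactors hℓ
    haveI : Fact ℓ.Prime := ⟨hℓp⟩
    haveI : (Ideal.span {(ℓ : ℤ)}).IsMaximal := Int.ideal_span_isMaximal_of_prime ℓ
    have hinj : Set.InjOn (fun v : HeightOneSpectrum (𝓞 ↥(κ.layer n)) => v.asIdeal)
        {v | v.asIdeal ∈ (Ideal.span {(ℓ : ℤ)}).primesOver (𝓞 ↥(κ.layer n))} := fun v _ v' _ h => HeightOneSpectrum.ext h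
    have hmaps : Set.MapsTo (fun v : HeightOneSpectrum (𝓞 ↥(κ.layer n)) => v.asIdeal)
        {v | v.asIdeal ∈ (Ideal.span {(ℓ : ℤ)}).primesOver (𝓞 ↥(κ.layer n))}
        ((Ideal.span {(ℓ : ℤ)}).primesOver (𝓞 ↥(κ.layer n))) := fun v hv => hv
    have hfinT : ((Ideal.span {(ℓ : ℤ)}).primesOver (𝓞 ↥(κ.layer n))).Finite := IsDedekindDomain.primesOver_finite _ _
    refine ⟨Set.Finite.of_injOn hmaps hinj hfinT, ?_⟩
    calc ({v : HeightOneSpectrum (𝓞 ↥(κ.layer n)) | v.asIdeal ∈ (Ideal.span {(ℓ : ℤ)}).primesOver (𝓞 ↥(κ.layer n))}).ncard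
        ≤ ((Ideal.span {(ℓ : ℤ)}).primesOver (𝓞 ↥(κ.layer n))).ncard := Set.ncard_le_ncard_of_injOn _ hmaps hinj hfinT
      _ ≤ (ℓ ^ (p - 1) - 1) * (p - 1) := ncard_primesOver_layer_le_odd hodd hκ n hℓp
  calc {v : HeightOneSpectrum (𝓞 ↥(κ.layer n)) | v.asIdeal.ramificationIdxIn (𝓞 ↥(j'.fieldRange ⊔ κ.layer n)) ≠ 1}.ncard
      ≤ (⋃ ℓ ∈ P, {v : HeightOneSpectrum (𝓞 ↥(κ.layer n)) |
          v.asIdeal ∈ (Ideal.span {(ℓ : ℤ)}).primesOver (𝓞 ↥(κ.layer n))}).ncard :=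
        Set.ncard_le_ncard hcover (Set.Finite.biUnion P.finite_toSet fun ℓ hℓ => (hfin ℓ hℓ).1)
    _ ≤ ∑ ℓ ∈ P, ({v : HeightOneSpectrum (𝓞 ↥(κ.layer n)) |
          v.asIdeal ∈ (Ideal.span {(ℓ : ℤ)}).primesOver (𝓞 ↥(κ.layer n))}).ncard := Finset.set_ncard_biUnion_le P _
    _ ≤ ∑ ℓ ∈ P, (ℓ ^ (p - 1) - 1) * (p - 1) := Finset.sum_le_sum fun ℓ hℓ => (hfin ℓ hℓ).2

/-! ## §3 `μ_p = 0` for cyclic fields of degree `p` -/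

/-- **Per-layer rank bound, unconditionally**: for `p` odd, `κ` a cyclotomic `ℤ_p`-extension of `ℚ`, `K'/ℚ` Galois of degree `p` with
`κ ∘ res` onto, and every `n`: `rank_p Cl((K'ℚ_∞)_n) ≤ p · (2 · rank_p Cl(ℚ_n) + T(K'))`, `T(K') = ∑_{ℓ ∣ disc K'} (ℓ^{p−1} − 1)(p − 1)`
(the general ascent bound of `classGroupPRank_restrict_le_of_isGalois_of_finrank_eq_of_odd` — Chevalley for odd `p`, the
`(σ−1)`-filtration — with the ramification bound of §2; the base term vanishes, `rank_p Cl(ℚ_n) = 0` by Iwasawa 1956: the sharp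
form `≤ p · T(K')` is §4's `classGroupPRank_restrict_rat_le_mul_ramificationBound_odd`).
[cite: Iwasawa1973MuInvariants, Thm. 2 (ℓ odd)] [cite: Washington1997, §13.1 and §13.3 Prop. 13.23] -/
theorem classGroupPRank_restrict_rat_le_of_isGalois_of_finrank_eq_odd (hodd : p ≠ 2) {κ : ZpExtension ℚ p} (hκ : κ.IsCyclotomic)
    (K' : Type) [Field K'] [NumberField K'] [IsGalois ℚ K'] (hdeg : Module.finrank ℚ K' = p)
    (hK' : Function.Surjective (κ.toContinuousMonoidHom.comp (absGaloisRestrict ℚ K'))) (n : ℕ) :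
    classGroupPRank (κ.restrict K' hK') n ≤
      p * (2 * classGroupPRank κ n + ∑ ℓ ∈ (NumberField.discr K').natAbs.primeFactors, (ℓ ^ (p - 1) - 1) * (p - 1)) :=
  classGroupPRank_restrict_le_of_isGalois_of_finrank_eq_of_odd hodd κ K' hdeg hK' (absEmbedding ℚ K') n _
    (ncard_ramified_layer_fieldRange_sup_layer_le hodd hκ K' hdeg hK' (absEmbedding ℚ K') n)

/-- **Iwasawa's `μ_p = 0` for every Galois number field of odd prime degree `p`, unconditionally (no Ferrero–Washington).**  `p` odd,
`κ` a cyclotomic `ℤ_p`-extension of `ℚ`, `K'/ℚ` Galois of degree `p` (cyclic) with `κ ∘ res_{K'/ℚ}` onto (`K'` is not the first layer `ℚ_1`):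
`ClassicalMuVanishes (κ|_{K'})`, i.e. `e_n(K'ℚ_∞/K') = λ n + ν` for `n ≫ 0` — from `classicalMuVanishes_rat` (Iwasawa 1956) by the odd-`p`
ascent `classicalMuVanishes_restrict_of_isGalois_of_finrank_eq_of_odd` (Iwasawa 1973) with the ramification bound of §2.
[cite: Iwasawa1973MuInvariants, Thm. 2 (ℓ odd)] [cite: Washington1997, §13.3 Prop. 13.23, Thm. 7.15 (the abelian case via Ferrero–Washington, for comparison)] -/
theorem classicalMuVanishes_restrict_rat_of_isGalois_of_finrank_eq_odd (hodd : p ≠ 2) {κ : ZpExtension ℚ p} (hκ : κ.IsCyclotomic)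
    (K' : Type) [Field K'] [NumberField K'] [IsGalois ℚ K'] (hdeg : Module.finrank ℚ K' = p)
    (hK' : Function.Surjective (κ.toContinuousMonoidHom.comp (absGaloisRestrict ℚ K'))) :
    ClassicalMuVanishes (κ.restrict K' hK') :=
  classicalMuVanishes_restrict_of_isGalois_of_finrank_eq_of_odd hodd κ K' hdeg hK' (absEmbedding ℚ K') _
    (ncard_ramified_layer_fieldRange_sup_layer_le hodd hκ K' hdeg hK' (absEmbedding ℚ K')) (classicalMuVanishes_rat κ)

/-! ## §4 `e_n(ℚ_∞/ℚ) = 0`, `rank_p Cl(ℚ_n) = 0`, and the SHARP per-layer bound `rank_p Cl((K'ℚ_∞)_n) ≤ p · T(K')`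

Appended 2026-08-29 (seat `bsd-potss-rkm` g46) to discharge the referee's note on §3 (cell `bsd-potss`, ref g100): the
docstrings of the header and of `classGroupPRank_restrict_rat_le_of_isGalois_of_finrank_eq_odd` ANNOUNCE the bound
`≤ p · T(K')`, while the landed statement carries the base term `2 · rank_p Cl(ℚ_n)` of the general ascent
(`≤ p · (2 · rank_p Cl(ℚ_n) + T(K'))`).  The two agree because `rank_p Cl(ℚ_n) = 0`: every layer `ℚ_n` of every
`ℤ_p`-extension of `ℚ` has class number prime to `p` (Iwasawa 1956: `h(ℚ) = 1` and exactly one prime of `ℤ` above `p` —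
the tree theorem `iwasawa1956_classNumberPExp_eq_zero_of_not_dvd_classNumber_of_unique_prime_holds`, exactly as consumed by
`classicalMuVanishes_rat`).  This section PROVES that (`classNumberPExp_rat_eq_zero`, `not_dvd_classNumber_layer_rat`,
`classGroupPRank_rat_eq_zero`) and derives the announced sharp form `classGroupPRank_restrict_rat_le_mul_ramificationBound_odd`.
Nothing above is edited (append-only). -/

/-- The two hypotheses of Iwasawa 1956 at the base `ℚ`: `p ∤ h(ℚ) = 1` (Mathlib `Rat.classNumber_eq`) and `(p)` is the UNIQUE
height-one prime of `𝓞 ℚ` containing `p` (Mathlib `Rat.HeightOneSpectrum.primesEquiv`).  (The same two bullets are proved inline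
in `classicalMuVanishes_rat`; recorded here as a lemma so that the `e_n = 0` form below is one line.)
[cite: Washington1997, Prop. 13.22 (`p ∤ h(ℚ_n)`: `ℚ_n/ℚ` totally ramified at `p` only)] -/
theorem rat_not_dvd_classNumber_and_existsUnique_heightOneSpectrum_mem :
    ¬ p ∣ NumberField.classNumber ℚ ∧
      ∃! v : IsDedekindDomain.HeightOneSpectrum (𝓞 ℚ), ((p : ℕ) : 𝓞 ℚ) ∈ v.asIdeal := by
  refine ⟨?_, ?_⟩
  · rw [Rat.classNumber_eq, Nat.dvd_one]; exact hp.out.ne_one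
  · have key : ∀ w : IsDedekindDomain.HeightOneSpectrum (𝓞 ℚ), ((p : ℕ) : 𝓞 ℚ) ∈ w.asIdeal ↔
        Rat.HeightOneSpectrum.natGenerator w = p := by
      intro w
      rw [← (Nat.prime_dvd_prime_iff_eq (Rat.HeightOneSpectrum.prime_natGenerator w) hp.out),
        Rat.HeightOneSpectrum.natGenerator_dvd_iff, ← map_natCast (Rat.IsIntegralClosure.intEquiv (𝓞 ℚ)) p,
        Ideal.apply_mem_of_equiv_iff]
    refine ⟨Rat.HeightOneSpectrum.primesEquiv.symm ⟨p, hp.out⟩, ?_, fun w hw => ?_⟩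
    · change ((p : ℕ) : 𝓞 ℚ) ∈ (Rat.HeightOneSpectrum.primesEquiv.symm ⟨p, hp.out⟩).asIdeal
      rw [key]
      exact congrArg Subtype.val (Rat.HeightOneSpectrum.primesEquiv.apply_symm_apply ⟨p, hp.out⟩)
    · apply Rat.HeightOneSpectrum.primesEquiv.injective
      rw [Equiv.apply_symm_apply]
      exact Subtype.ext ((key w).mp hw)

/-- **`e_n = 0` for every `ℤ_p`-extension of `ℚ` and every `n`** (`ord_p h(ℚ_n) = 0`): Iwasawa 1956 at the base `ℚ`
(`h(ℚ) = 1`, one prime above `p`), for ANY `ℤ_p`-extension `κ` of `ℚ` (there is only the cyclotomic one, but the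
statement does not need that). [cite: Washington1997, Prop. 13.22] [cite: Greenberg2001IwasawaPastPresent, Prop. 2.1 p. 339] -/
theorem classNumberPExp_rat_eq_zero (κ : ZpExtension ℚ p) (n : ℕ) : classNumberPExp κ n = 0 :=
  iwasawa1956_classNumberPExp_eq_zero_of_not_dvd_classNumber_of_unique_prime_holds ℚ p
    rat_not_dvd_classNumber_and_existsUnique_heightOneSpectrum_mem.1
    rat_not_dvd_classNumber_and_existsUnique_heightOneSpectrum_mem.2 κ n

/-- **`p ∤ h(ℚ_n)`** for every layer `ℚ_n` of every `ℤ_p`-extension of `ℚ` (Washington Prop. 13.22: «`p` does not divide the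
class number of `ℚ_n`»; in particular `p ∤ h(ℚ(ζ_{p^{n+1}})⁺ ∩ ℚ_∞)`). [cite: Washington1997, Prop. 13.22] -/
theorem not_dvd_classNumber_layer_rat (κ : ZpExtension ℚ p) (n : ℕ) [NumberField ↥(κ.layer n)] :
    ¬ p ∣ NumberField.classNumber ↥(κ.layer n) :=
  not_dvd_classNumber_layer_of_classNumberPExp_eq_zero
    iwasawa1956_classNumberPExp_eq_zero_of_not_dvd_classNumber_of_unique_prime_holds
    rat_not_dvd_classNumber_and_existsUnique_heightOneSpectrum_mem.1
    rat_not_dvd_classNumber_and_existsUnique_heightOneSpectrum_mem.2 κ n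

/-- **`rank_p Cl(ℚ_n) = 0`** for every layer of every `ℤ_p`-extension of `ℚ` (`rank_p A_n ≤ ord_p #A_n = e_n = 0`).
[cite: Washington1997, Prop. 13.22] -/
theorem classGroupPRank_rat_eq_zero (κ : ZpExtension ℚ p) (n : ℕ) : classGroupPRank κ n = 0 :=
  Nat.eq_zero_of_le_zero ((classGroupPRank_le_classNumberPExp κ n).trans (classNumberPExp_rat_eq_zero κ n).le)

/-- **Per-layer rank bound in the ANNOUNCED sharp form**: for `p` odd, `κ` a cyclotomic `ℤ_p`-extension of `ℚ`, `K'/ℚ` Galois of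
degree `p` with `κ ∘ res` onto, and every `n`:
`rank_p Cl((K'ℚ_∞)_n) ≤ p · T(K')`, `T(K') = ∑_{ℓ ∣ disc K'} (ℓ^{p−1} − 1)(p − 1)` — §3's
`classGroupPRank_restrict_rat_le_of_isGalois_of_finrank_eq_odd` with its base term `2 · rank_p Cl(ℚ_n)` killed by
`classGroupPRank_rat_eq_zero`.  This is the statement the §3 docstrings describe in words.
[cite: Iwasawa1973MuInvariants, Thm. 2 (ℓ odd)] [cite: Washington1997, §13.3 Prop. 13.23 and Prop. 13.22] -/
theorem classGroupPRank_restrict_rat_le_mul_ramificationBound_odd (hodd : p ≠ 2) {κ : ZpExtension ℚ p} (hκ : κ.IsCyclotomic)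
    (K' : Type) [Field K'] [NumberField K'] [IsGalois ℚ K'] (hdeg : Module.finrank ℚ K' = p)
    (hK' : Function.Surjective (κ.toContinuousMonoidHom.comp (absGaloisRestrict ℚ K'))) (n : ℕ) :
    classGroupPRank (κ.restrict K' hK') n ≤
      p * ∑ ℓ ∈ (NumberField.discr K').natAbs.primeFactors, (ℓ ^ (p - 1) - 1) * (p - 1) := by
  have h := classGroupPRank_restrict_rat_le_of_isGalois_of_finrank_eq_odd hodd hκ K' hdeg hK' n
  rwa [classGroupPRank_rat_eq_zero κ n, mul_zero, zero_add] at h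

end Literature.NumberTheory.IwasawaTheory

end
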